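import Summits.Ventures.CertifiedManyBodySolver.Certificates.SymRungW3Box2d3.Data.Chunk0
import Summits.Ventures.CertifiedManyBodySolver.Certificates.SymRungW3Box2d3.Data.Chunk1
import Summits.Ventures.CertifiedManyBodySolver.Theorems.M3x2EdgeSplitSymReplaySound

/-!
# Certificate `SymRungW3Box2d3` — closing module (2 data chunks)
Word-form Ward × affine-`D₄` window certificate for the 2D Hubbard model at `(t,t',U,n) = (1,0,8,7/8)`, replayed by the TREE checker
(`symCheckV`/`symCheck`, T1 `…Theorems.M3x2EdgeSplitSymReplaySyntax` + `…SyntaxV`) from an INTEGER TOKEN STRING decoded by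
`decodeSymCert ∘ toks` (`…Theorems.M3x2EdgeSplitSymReplayDecode`).  Source JSON `rs_w3d2_box2d3_rbl_K40.rev7_comp.symcert2.json.gz` sha256 605737468b0593670c39cd925b54d076dd3c7953fdf0914f96390a979bd9a8e8
(format hub-lb-symcert-word/2, layout sym-plan-1 rev 7 (gramM), indexing comp); value -618858676065167666234883/604462909807314587353088 = -1.023815797503; 80627 tokens.
Producer chain (hub-lb-sym-eng-4 g1, 2026-08-28): kit j306041 `symeng4-rungscan` — l1sym 0.4.5a (l1g18-recert045 byte copies, ferm.c 140b971b50f3ea09…) gen + symsdp IPM, member `rs_w3d2_box2d3` = 3×3 degree-2 window ⊕ all degree-≤3 words on the 2×2 plaquette, [SP] D₄×SU(2)hw blocks1 (Z2 realised), Ward rows + eom 4: problem0 sha256 620e6514fc9e6f2e51b2f2c53f305f3f6f857b97d60f90b17a35f8e502beed05, blocks1 d2902689d74b98c84f6a5102fd7f73f1953e4b75949dc891ebd77e2e5b6f03be; kit j306612 `symeng4-rungcert` — hub-lb-sym-eng-1 g1 `rbl_cert.py` (round-before-lift, K = 40; exact bound re-derived with stdlib Fractions) → cert0 e8d2979c87edc00c542914af612aa71cc17ed52648540a9bc12c0bfb130c0f17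 / factor 63f5e1b421a534ca2beb8bce9cb01684213e965f702304e8b93a7730f3da3f83 → `v0_to_symcert.py` (stages A–C, word-level self-check: value BIT-EQUAL, closure residual 0) → `emit_rev7.py --indexing comp` → the source JSON below. Referee: hub-lb-sym-ref-2 g0 «SIGN RUNG W3BOX» (hub-lb STATUS 2026-08-28T11:13:17Z): PASS ×4 (replay_C 0.6 GRAM + FACTOR modes, symcert_replay 0.3 on comp + sector JSON), planted twins REJECT ×2. All files: pub/hub-lb/hub-lb-sym-eng-4/g1-rung/ (SHA256SUMS).
Axioms of the bound theorems: propext, Classical.choice, Quot.sound + `Lean.ofReduceBool` (ONE `native_decide` on data; computational grade).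
No summit statement is proved here; a certified bound is a number with a certificate; nothing here predicts superconductivity.
-/

namespace Summit.Ventures.CertifiedManyBodySolver.Certificates.SymRungW3Box2d3

open Summit.Ventures.CertifiedManyBodySolver.Theorems.SymReplay

/-- **The certificate** (decoded at evaluation time from the token string). -/
def cert : SymCert := decodeSymCert (toksOf [chunk0, chunk1])

/-- The data string decodes without leftover tokens. -/
theorem data_decodeRest : decodeRest (toksOf [chunk0, chunk1]) = 0 := by native_decide

/-- The executed word-form checker ACCEPTS `cert` (compiled evaluation; computational grade). -/
theorem cert_checkV : symCheckV cert = true := by native_decide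

/-- Hence T1's specification checker accepts it (`symCheckV_eq`). -/
theorem cert_check : symCheck cert = true := symCheck_of_symCheckV _ cert_checkV

/-- The certified value, evaluated (= -618858676065167666234883/604462909807314587353088 = -1.023815797503). -/
theorem cert_value : symValue cert = ((-618858676065167666234883 : ℚ) / 604462909807314587353088) := by native_decide

/-- **Unconditional lower bound on the ground-state energy density of the 2D Hubbard model at `(t,t',U,n) = (1,0,8,7/8)`**
from the kernel-replayed certificate (via `energyDensity_ge_symValue`, T10). -/
theorem energyDensityTT'_ge_symValue : ((symValue cert : ℚ) : ℝ) ≤ Literature.MathematicalPhysics.QuantumLattice.ThermodynamicLimit.energyDensityTT' 1 0 8 (7 / 8) :=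
  energyDensity_ge_symValue cert cert_check

/-- The same bound for the `t' = 0` energy density `energyDensity2D 1 8 (7/8)` (`energyDensityTT'_zero`). -/
theorem energyDensity2D_ge_symValue : ((symValue cert : ℚ) : ℝ) ≤ Literature.MathematicalPhysics.QuantumLattice.ThermodynamicLimit.energyDensity2D 1 8 (7 / 8) := by
  have h := energyDensityTT'_ge_symValue
  rwa [Literature.MathematicalPhysics.QuantumLattice.ThermodynamicLimit.energyDensityTT'_zero] at h

/-- **Exact form**: the certified dyadic `-618858676065167666234883/604462909807314587353088` bounds `e₀(t=1, U=8, n=7/8)` from below. -/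
theorem energyDensity2D_ge_exact : ((-618858676065167666234883 : ℝ) / 604462909807314587353088) ≤ Literature.MathematicalPhysics.QuantumLattice.ThermodynamicLimit.energyDensity2D 1 8 (7 / 8) := by
  have h := energyDensity2D_ge_symValue
  rw [cert_value] at h
  exact_mod_cast h

/-- **Decimal form**: `-1.0239 ≤ e₀(t=1, U=8, n=7/8)` (square-lattice Hubbard model, thermodynamic limit) — improves the tree's
`energyDensity2D_one_eight_sevenEighths_ge` (`−1.0432`, Pauli–doublon LCE). -/
theorem energyDensity2D_one_eight_sevenEighths_ge_m1p0239 : (-1.0239 : ℝ) ≤ Literature.MathematicalPhysics.QuantumLattice.ThermodynamicLimit.energyDensity2D 1 8 (7 / 8) := by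
  have h := energyDensity2D_ge_symValue
  rw [cert_value] at h
  refine le_trans ?_ h
  norm_num

end Summit.Ventures.CertifiedManyBodySolver.Certificates.SymRungW3Box2d3
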